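import Literature.MathematicalPhysics.QuantumFieldTheory.Balaban1983to89.B9Thm310CommutatorBound389BMajorant
import Literature.MathematicalPhysics.QuantumFieldTheory.Balaban1983to89.B9CubeLettersInvReadDictB

/-!
# `Balaban1983to89.B9CubeLettersInvReadDictBMajorants` — T. Bałaban, *Propagators for lattice gauge theories in a background field*, Commun. Math.
# Phys. **99** (1985) 389–434 [Balaban1985BackgroundPropagators], Thm 3.3 p. 399 with (3.42) p. 397, BOND SECTOR: READ ⇒ the four [4]-(2.51) block
# MAJORANTS of the conj-`b` bond letters from the (3.42) block over the gauge-invariant test class — the bond-sector twin of p21's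
# `B9CubeLettersInvReadDict` §4 and the converse of this seat's `B9CubeLettersInvWriteDictB` (sub-row G-B9-LETTERS, DictB-READ §4)

statement-level skeleton of published theorems with citation tags; proofs where landed; nothing here is a claim about the Yang–Mills mass gap

PDF held: `paper:balaban1985-cmp99-background-propagators` (journal page = PDF page + 388); pp. 397, 399, 409 read from the held text layer; [4] =
[Balaban1984PropagatorsII] (2.51) p. 232 «|(Rλ)(x)| ≦ O(M⁻¹)e^{−δ₀d(x,y)}|λ| if supp λ ⊂ Bʲ(y), y ∈ Λ_j», followed by «Let us consider n operators R₁, R₂, …, R_n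
satisfying (2.51) with a constant O(1) instead of O(M⁻¹)» (the majorant shape `|(Tλ)(x)| ≤ K(y,y′)|λ|` of `B6RandomWalk.HasMajorant`); p. 399 Thm 3.3: «the
operator G(U) (a = 1) satisfies the inequalities (3.42)–(3.47), with G′(U) replaced by G(U) and λ replaced by a function J defined at bonds of the lattice T_η,
or Ω₀, and with values in g»; p. 409 l.3–5 «The operators constructed for this sequence, which we denote by G′_□(U), C_□(U) = (Q(U)G′_□²(U)Q*(U))⁻¹, G_□(U),
satisfy all the inequalities of Theorems 3.1–3.3 correspondingly».

WHAT THIS FILE IS.  `B9CubeLettersInvReadDictB` §4 made the (3.42) block `EBlock (kernelFamilyBInv i B cfg O par) B₀ δ U₁` of a bond letter POINTWISE over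
the class; E′₃'s `hasMajorant_conj_of_ball_boundB` turns a pointwise ball bound into the [4]-(2.51) block majorant of the conjugated letter on the real
coordinates `FBondY i × ι` (block map `(x, j) ↦ ιB(Δ(x))`, geometry `toB6 (geo9K i) Rr Hp`).  THIS FILE composes them — the four majorant families that the
Theorem 3.10 glue's `B9Thm310Whole.Local342G` asks of the cube letters `G_□(U)` («satisfy all the inequalities of Theorems 3.1–3.3»), in the product
shapes of this seat's WRITE half `B9CubeLettersInvWriteDictB.eBlock_kernelFamilyBInv_of_hasMajorant` (so READ-majorants ∘ WRITE is the identity up to the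
basis constant): for ANY ℝ-linear `G`, `D ν`, `Ds ν`, `L` agreeing pointwise with `O(cfg U₁)`, `∇_{U,ν}` (`cdB`), `∇*_{U,ν}` (`cdsB`), `Δ_U` (`lapB`) —
§1 ℂ-homogeneity of the bond-sector covariant differences (`cdB_smul`, `cdsB_smul`, `lapB_smul`); §2 ★★ `hasMajorant_conj_G_of_eBlockInvB` (profile `ℓ(a)²`),
`hasMajorant_D_mul_G_of_eBlockInvB` (`ℓ(a)`, every `ν`), `hasMajorant_G_mul_Ds_of_eBlockInvB` (`ℓ(a)`, every `ν`), `hasMajorant_L_mul_G_of_eBlockInvB` (profile `1`),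
constant `M₂(Σ_j‖b_j‖)·B₀`, SAME rate `δ`.
HONEST SCOPE.  Bookkeeping only: the (3.42) block is the HYPOTHESIS `hE`; corner-free members (a section `ιB` of `β`); no η-units in the bond family (`c_f`
rides inside `cdB ∕ cdsB`); nothing of Thm 3.3 asserted; nothing continuum ∕ OS ∕ mass gap ∕ Clay; YM mass gap NOT proved by any of this (Track A conditional
rung).  `--supports stmt-QuantumFields-19200`.  Net new unproved facts: 0.
-/

noncomputable section

namespace Literature.MathematicalPhysics.QuantumFieldTheory.Balaban1983to89.B9CubeLettersInvReadDictBMajorants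

open Node00 B9CubeLettersInvReadings
open B9CubeLettersInvReadDictB (norm_O_le_of_eBlockInvB norm_cdB_O_le_of_eBlockInvB norm_O_cdsB_le_of_eBlockInvB norm_lapB_O_le_of_eBlockInvB)
open B9Thm310CommutatorBound389BMajorant (hasMajorant_conj_of_ball_boundB norm_liftY_le_abs)
open B6GlobalChartV1 (PV blkV1)
open B6Ineq2142KLevelV1 (β)
open B6KLevelCensusIndexV1 (KIdx)
open B6RandomWalk (HasMajorant hasMajorant_mono)
open B9Thm34Ext (toB6)
open B9FromB6 (EBlock)
open B9GeoNormsKLevelV1 (geo9K geo9K_supNorm_nonneg)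
open B9Eq352DivFormLetters (conj)
open B9BackgroundsKLevelV1 (shiftsV1)
open scoped Matrix

variable {d ℓ : ℕ} {hd : 1 ≤ d + 1} {hL : Odd (ℓ + 1) ∧ 1 < ℓ + 1} {b₀ b₁ : ℝ}
variable {𝔸 : Type} [NormedRing 𝔸] [NormedAlgebra ℂ 𝔸] [CompleteSpace 𝔸]
variable {ι : Type} [Fintype ι]
variable (i : KIdx d ℓ hd hL b₀ b₁) (b : Module.Basis ι ℝ 𝔸)

/-! ## §1 The bond-sector covariant differences commute with complex scalars -/

section Smul

/-- `∇_{U,μ}(cA) = c∇_{U,μ}A` on the bond sector. [cite: Balaban1985BackgroundPropagators, (3.3) p.390, bookkeeping] -/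
theorem cdB_smul (U : CfgY 𝔸 i) (μ : Fin (d + 1)) (c : ℂ) (A : FBondY i → 𝔸) : cdB i U μ (c • A) = c • cdB i U μ A := by
  funext x
  simp only [cdB, Pi.smul_apply]
  have h1 : (fun s => c • A ⟨s, x.dir⟩) = c • (fun s => A ⟨s, x.dir⟩) := by
    funext s; simp only [Pi.smul_apply]
  rw [h1, B9Eq39Adjoint.covD_smul, smul_comm]

/-- `∇*_{U,μ}(cA) = c∇*_{U,μ}A` on the bond sector. [cite: Balaban1985BackgroundPropagators, (3.8) p.392, bookkeeping] -/
theorem cdsB_smul (U : CfgY 𝔸 i) (μ : Fin (d + 1)) (c : ℂ) (A : FBondY i → 𝔸) : cdsB i U μ (c • A) = c • cdsB i U μ A := by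
  funext x
  simp only [cdsB, Pi.smul_apply]
  have h1 : (fun s => c • A ⟨s, x.dir⟩) = c • (fun s => A ⟨s, x.dir⟩) := by
    funext s; simp only [Pi.smul_apply]
  rw [h1, B9Eq39Adjoint.covDstar_smul, smul_comm]

/-- `Δ_U(cA) = cΔ_U A` on the bond sector. [cite: Balaban1985BackgroundPropagators, (3.23) p.395, bookkeeping] -/
theorem lapB_smul (U : CfgY 𝔸 i) (c : ℂ) (A : FBondY i → 𝔸) : lapB i U (c • A) = c • lapB i U A := by
  funext x
  simp only [lapB, Pi.smul_apply, Finset.smul_sum]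
  refine Finset.sum_congr rfl fun μ _ => ?_
  rw [cdB_smul, cdsB_smul, Pi.smul_apply]

end Smul

/-! ## §2 READ ⇒ the four [4]-(2.51) block majorants of the conj-`b` bond letters -/

section Majorants

variable {B : B9.Backgrounds} (cfg : B.Cfg → CfgY 𝔸 i) (O : BondOpY 𝔸 i) (par : BondParY 𝔸 i) {B₀ δ : ℝ} {U₁ : B.Cfg}
variable [Fintype (geo9K i).Site] {Rr : ℝ} {Hp : Prop}

omit [NormedRing 𝔸] [NormedAlgebra ℂ 𝔸] [CompleteSpace 𝔸] [Fintype ι] [Fintype (geo9K i).Site] in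
/-- the profile `B₀·ℓ(a)^p·e^{−δd(a,a′)}` is non-negative for `B₀ ≥ 0`. [cite: Balaban1985BackgroundPropagators, (3.42) p.397, bookkeeping] -/
private theorem profile_nonneg (hB₀ : 0 ≤ B₀) (p : ℕ) (a a' : IBondY i) :
    0 ≤ B₀ * (geo9K i).len a ^ p * Real.exp (-(δ * (geo9K i).dist a a')) :=
  mul_nonneg (mul_nonneg hB₀ (pow_nonneg (B6KLevelCensusIndexV1.len_pos i a).le p)) (Real.exp_pos _).le

/-- ★★ **entry 0 ⇒ the majorant of `conj b G`**, `G` any ℝ-linear map agreeing with `O(cfg U₁)`: constant `M₂(Σ‖b_j‖)B₀`, profile `ℓ(a)²`, SAME rate `δ` — the `e0`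
shape of `B9Thm310Whole.Local342G` ∕ the `h0` input of `B9CubeLettersInvWriteDictB.eBlock_kernelFamilyBInv_of_hasMajorant`.
[cite: Balaban1985BackgroundPropagators, Thm 3.3 p.399 with (3.42) p.397 (first member); Balaban1984PropagatorsII, (2.51) p.232] -/
theorem hasMajorant_conj_G_of_eBlockInvB (hE : EBlock (kernelFamilyBInv i B cfg O par) B₀ δ U₁) (hB₀ : 0 ≤ B₀)
    (ιB : BlkY i → IBondY i) (hι : ∀ s, β i.hN i.D i.hk (ιB s) = s)
    {M₂ : ℝ} (hM₂ : 0 ≤ M₂) (hrepr : ∀ (v : 𝔸) (j : ι), |b.repr v j| ≤ M₂ * ‖v‖)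
    (G : Module.End ℝ (FBondY i → 𝔸)) (hG : ∀ Λ, G Λ = O (cfg U₁) Λ) :
    HasMajorant (g := toB6 (geo9K i) Rr Hp) (fun p : FBondY i × ι => ιB (blkV1 i.hN i.D p.1)) (conj b G)
      (fun a a' => M₂ * (∑ j, ‖b j‖) * B₀ * (geo9K i).len a ^ 2 * Real.exp (-(δ * (geo9K i).dist a a'))) := by
  have hT : ∀ (c : ℂ) (Λ : FBondY i → 𝔸), G (c • Λ) = c • G Λ := fun c Λ => by rw [hG, hG, map_smul]
  refine hasMajorant_mono (g := toB6 (geo9K i) Rr Hp) _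
    (hasMajorant_conj_of_ball_boundB i b (Rr := Rr) (Hp := Hp) G hT ιB hι hM₂ hrepr
      (fun a a' => B₀ * (geo9K i).len a ^ 2 * Real.exp (-(δ * (geo9K i).dist a a'))) (profile_nonneg i hB₀ 2) ?_)
    fun a a' => le_of_eq (by ring)
  intro J y y' hs E hE1 x hx
  rw [hG]
  exact norm_O_le_of_eBlockInvB i b cfg O par hE hM₂ hrepr J y y' hs ⟨liftY J E, norm_liftY_le_abs i J hE1⟩ hx

/-- ★★ **entry 1 ⇒ the majorant of `conj b (D ν) * conj b G`** (`D ν` any ℝ-linear map agreeing with `∇_{U,ν}` at `cfg U₁`, on the LEFT): profile `ℓ(a)`, SAME rate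
— the `h1` input of the WRITE half. [cite: Balaban1985BackgroundPropagators, Thm 3.3 p.399 with (3.42) p.397 (second member); Balaban1984PropagatorsII, (2.51)–(2.52) p.232] -/
theorem hasMajorant_D_mul_G_of_eBlockInvB (hE : EBlock (kernelFamilyBInv i B cfg O par) B₀ δ U₁) (hB₀ : 0 ≤ B₀)
    (ιB : BlkY i → IBondY i) (hι : ∀ s, β i.hN i.D i.hk (ιB s) = s)
    {M₂ : ℝ} (hM₂ : 0 ≤ M₂) (hrepr : ∀ (v : 𝔸) (j : ι), |b.repr v j| ≤ M₂ * ‖v‖)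
    (G : Module.End ℝ (FBondY i → 𝔸)) (hG : ∀ Λ, G Λ = O (cfg U₁) Λ)
    (D : Fin (d + 1) → Module.End ℝ (FBondY i → 𝔸)) (hD : ∀ ν Λ, D ν Λ = cdB i (cfg U₁) ν Λ) (ν : Fin (d + 1)) :
    HasMajorant (g := toB6 (geo9K i) Rr Hp) (fun p : FBondY i × ι => ιB (blkV1 i.hN i.D p.1)) (conj b (D ν) * conj b G)
      (fun a a' => M₂ * (∑ j, ‖b j‖) * B₀ * (geo9K i).len a * Real.exp (-(δ * (geo9K i).dist a a'))) := by
  have hT : ∀ (c : ℂ) (Λ : FBondY i → 𝔸), (D ν * G) (c • Λ) = c • (D ν * G) Λ := fun c Λ => by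
    rw [Module.End.mul_apply, Module.End.mul_apply, hG, hG, map_smul, hD, hD, cdB_smul]
  rw [← B9Eq352DivFormLetters.conj_mul]
  refine hasMajorant_mono (g := toB6 (geo9K i) Rr Hp) _
    (hasMajorant_conj_of_ball_boundB i b (Rr := Rr) (Hp := Hp) (D ν * G) hT ιB hι hM₂ hrepr
      (fun a a' => B₀ * (geo9K i).len a ^ 1 * Real.exp (-(δ * (geo9K i).dist a a'))) (profile_nonneg i hB₀ 1) ?_)
    fun a a' => le_of_eq (by ring)
  intro J y y' hs E hE1 x hx
  rw [Module.End.mul_apply, hG, hD, pow_one]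
  exact norm_cdB_O_le_of_eBlockInvB i b cfg O par hE hM₂ hrepr J y y' hs ⟨liftY J E, norm_liftY_le_abs i J hE1⟩ ν hx

/-- ★★ **entry 2 ⇒ the majorant of `conj b G * conj b (Ds ν)`** (`Ds ν` any ℝ-linear map agreeing with `∇*_{U,ν}` at `cfg U₁`, on the RIGHT): profile `ℓ(a)`, SAME
rate — the `h2` input of the WRITE half. [cite: Balaban1985BackgroundPropagators, Thm 3.3 p.399 with (3.42) p.397 (third member); Balaban1984PropagatorsII, (2.51)–(2.52) p.232] -/
theorem hasMajorant_G_mul_Ds_of_eBlockInvB (hE : EBlock (kernelFamilyBInv i B cfg O par) B₀ δ U₁) (hB₀ : 0 ≤ B₀)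
    (ιB : BlkY i → IBondY i) (hι : ∀ s, β i.hN i.D i.hk (ιB s) = s)
    {M₂ : ℝ} (hM₂ : 0 ≤ M₂) (hrepr : ∀ (v : 𝔸) (j : ι), |b.repr v j| ≤ M₂ * ‖v‖)
    (G : Module.End ℝ (FBondY i → 𝔸)) (hG : ∀ Λ, G Λ = O (cfg U₁) Λ)
    (Ds : Fin (d + 1) → Module.End ℝ (FBondY i → 𝔸)) (hDs : ∀ ν Λ, Ds ν Λ = cdsB i (cfg U₁) ν Λ) (ν : Fin (d + 1)) :
    HasMajorant (g := toB6 (geo9K i) Rr Hp) (fun p : FBondY i × ι => ιB (blkV1 i.hN i.D p.1)) (conj b G * conj b (Ds ν))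
      (fun a a' => M₂ * (∑ j, ‖b j‖) * B₀ * (geo9K i).len a * Real.exp (-(δ * (geo9K i).dist a a'))) := by
  have hT : ∀ (c : ℂ) (Λ : FBondY i → 𝔸), (G * Ds ν) (c • Λ) = c • (G * Ds ν) Λ := fun c Λ => by
    rw [Module.End.mul_apply, Module.End.mul_apply, hDs, hDs, cdsB_smul, hG, hG, map_smul]
  rw [← B9Eq352DivFormLetters.conj_mul]
  refine hasMajorant_mono (g := toB6 (geo9K i) Rr Hp) _
    (hasMajorant_conj_of_ball_boundB i b (Rr := Rr) (Hp := Hp) (G * Ds ν) hT ιB hι hM₂ hrepr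
      (fun a a' => B₀ * (geo9K i).len a ^ 1 * Real.exp (-(δ * (geo9K i).dist a a'))) (profile_nonneg i hB₀ 1) ?_)
    fun a a' => le_of_eq (by ring)
  intro J y y' hs E hE1 x hx
  rw [Module.End.mul_apply, hG, hDs, pow_one]
  exact norm_O_cdsB_le_of_eBlockInvB i b cfg O par hE hM₂ hrepr J y y' hs ⟨liftY J E, norm_liftY_le_abs i J hE1⟩ ν hx

/-- ★★ **entry 3 ⇒ the majorant of `conj b L * conj b G`** (`L` any ℝ-linear map agreeing with `Δ_U` at `cfg U₁`): profile `1`, SAME rate — the `h3` input of the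
WRITE half. [cite: Balaban1985BackgroundPropagators, Thm 3.3 p.399 with (3.42) p.397 (fourth member); Balaban1984PropagatorsII, (2.51)–(2.52) p.232] -/
theorem hasMajorant_L_mul_G_of_eBlockInvB (hE : EBlock (kernelFamilyBInv i B cfg O par) B₀ δ U₁) (hB₀ : 0 ≤ B₀)
    (ιB : BlkY i → IBondY i) (hι : ∀ s, β i.hN i.D i.hk (ιB s) = s)
    {M₂ : ℝ} (hM₂ : 0 ≤ M₂) (hrepr : ∀ (v : 𝔸) (j : ι), |b.repr v j| ≤ M₂ * ‖v‖)
    (G : Module.End ℝ (FBondY i → 𝔸)) (hG : ∀ Λ, G Λ = O (cfg U₁) Λ)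
    (L : Module.End ℝ (FBondY i → 𝔸)) (hL : ∀ Λ, L Λ = lapB i (cfg U₁) Λ) :
    HasMajorant (g := toB6 (geo9K i) Rr Hp) (fun p : FBondY i × ι => ιB (blkV1 i.hN i.D p.1)) (conj b L * conj b G)
      (fun a a' => M₂ * (∑ j, ‖b j‖) * B₀ * 1 * Real.exp (-(δ * (geo9K i).dist a a'))) := by
  have hT : ∀ (c : ℂ) (Λ : FBondY i → 𝔸), (L * G) (c • Λ) = c • (L * G) Λ := fun c Λ => by
    rw [Module.End.mul_apply, Module.End.mul_apply, hG, hG, map_smul, hL, hL, lapB_smul]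
  rw [← B9Eq352DivFormLetters.conj_mul]
  refine hasMajorant_mono (g := toB6 (geo9K i) Rr Hp) _
    (hasMajorant_conj_of_ball_boundB i b (Rr := Rr) (Hp := Hp) (L * G) hT ιB hι hM₂ hrepr
      (fun a a' => B₀ * (geo9K i).len a ^ 0 * Real.exp (-(δ * (geo9K i).dist a a'))) (profile_nonneg i hB₀ 0) ?_)
    fun a a' => le_of_eq (by ring)
  intro J y y' hs E hE1 x hx
  rw [Module.End.mul_apply, hG, hL, pow_zero]
  exact norm_lapB_O_le_of_eBlockInvB i b cfg O par hE hM₂ hrepr J y y' hs ⟨liftY J E, norm_liftY_le_abs i J hE1⟩ hx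

end Majorants

end Literature.MathematicalPhysics.QuantumFieldTheory.Balaban1983to89.B9CubeLettersInvReadDictBMajorants

end
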